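import Mathlib
import HarnessLib
import Literature.MathematicalPhysics.StatisticalMechanics.LennardJonesClusters
import Summits.AtomisticToContinuum.Crystallization.Theorems.ContactSaturationLadderWindowAveraging
import Summits.AtomisticToContinuum.Crystallization.Theorems.ContactSaturationLadderWindowFloor

/-!
# Fraction transfer between window radii (support lemmas for `ContactSaturationLadder.LooseTextureRung`)

GS-free, energy-free counting geometry used by the decomp-a2c lens-1 line on the crux `LooseTextureRung` (node g22, «far-fraction profile»):
a LOCAL FRACTION bound — «every window `B(p,ρ)` centred within `ρ₁ + ρ` of `c` holds at most `φ·#B(p,ρ)` marked particles» — transfers to the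
big window with NO covering multiplicity:

* `card_le_of_localFraction` : `#F ≤ φ · #B(c, ρ₁ + 2ρ)` for every marked set `F ⊆ B(c,ρ₁)` — by integrating
  `p ↦ #(F ∩ B(p,ρ)) ≤ φ · #(B(c,ρ₁+2ρ) ∩ B(p,ρ))` over `ℝ³` (`ContactSaturationLadderWindowAveraging.integral_sum_indicator_closedBall`);
* `card_collar_le` : the collar `{ρ₁ < |y_i − c| ≤ ρ₁ + 2ρ}` of a `δ`-separated configuration holds at most `288·δ⁻³·ρ·ρ₁²` particles
  (`ContactSaturationLadderWindowFloor.card_layer_le`);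
* `card_le_of_localFraction_fill` : with a filling bound `ρ₁³ ≤ K·#B(c,ρ₁)` the marked fraction of `B(c,ρ₁)` is at most `φ·(1 + 288·K·δ⁻³·ρ/ρ₁)` —
  the loss factor tends to ONE as `ρ/ρ₁ → 0` (a one-radius rung becomes a loss-free bound at every larger radius).

No ground-state hypothesis, no potential: pure finite-configuration geometry in `ℝ³`.
-/

noncomputable section

namespace Summit.AtomisticToContinuum.Crystallization.Theorems.ContactSaturationLadderFractionTransfer

open scoped BigOperators Classical
open MeasureTheory Metric
open Summit.AtomisticToContinuum.Crystallization.Theorems.ContactSaturationLadderWindowAveraging (integrable_sum_indicator_closedBall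
  integral_sum_indicator_closedBall card_filter_mem_eq_sum sum_ite_mem_one)
open Summit.AtomisticToContinuum.Crystallization.Theorems.ContactSaturationLadderWindowFloor (card_layer_le)

variable {N : ℕ}

/-- **Averaging lemma** (GS-free, separation-free): if `F ⊆ B(c,ρ₁)` (as particles) and every window `B(p,ρ)` with `|p − c| ≤ ρ₁ + ρ` holds at
most `φ·#B(p,ρ)` particles of `F`, then `#F ≤ φ·#B(c, ρ₁ + 2ρ)`.  Proof: integrate `p ↦ #(F ∩ B(p,ρ)) ≤ φ·#(B(c,ρ₁+2ρ) ∩ B(p,ρ))` over `ℝ³`. -/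
theorem card_le_of_localFraction (y : Fin N → EuclideanSpace ℝ (Fin 3)) (c : EuclideanSpace ℝ (Fin 3)) {ρ ρ₁ φ : ℝ}
    (hρ : 0 < ρ) (hφ : 0 ≤ φ) (F : Finset (Fin N)) (hF : ∀ i ∈ F, dist (y i) c ≤ ρ₁)
    (hloc : ∀ p : EuclideanSpace ℝ (Fin 3), dist p c ≤ ρ₁ + ρ →
      ((F.filter fun i : Fin N => dist (y i) p ≤ ρ).card : ℝ) ≤ φ * ((Finset.univ.filter fun i : Fin N => dist (y i) p ≤ ρ).card : ℝ)) :
    (F.card : ℝ) ≤ φ * ((Finset.univ.filter fun i : Fin N => dist (y i) c ≤ ρ₁ + 2 * ρ).card : ℝ) := by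
  set S := Finset.univ.filter (fun i : Fin N => dist (y i) c ≤ ρ₁ + 2 * ρ) with hS
  set L : EuclideanSpace ℝ (Fin 3) → ℝ := fun p =>
    ∑ i, (closedBall (y i) ρ).indicator (fun _ => if i ∈ F then (1 : ℝ) else 0) p with hL
  set R : EuclideanSpace ℝ (Fin 3) → ℝ := fun p =>
    φ * ∑ i, (closedBall (y i) ρ).indicator (fun _ => if i ∈ S then (1 : ℝ) else 0) p with hR
  have hLR : L ≤ R := by
    intro p
    simp only [hL, hR]
    rw [← card_filter_mem_eq_sum, ← card_filter_mem_eq_sum]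
    by_cases hp : dist p c ≤ ρ₁ + ρ
    · refine le_trans (hloc p hp) (mul_le_mul_of_nonneg_left ?_ hφ)
      exact_mod_cast Finset.card_le_card fun i hi => by
        simp only [Finset.mem_filter, Finset.mem_univ, true_and, hS] at hi ⊢
        refine ⟨?_, hi⟩
        have := dist_triangle (y i) p c
        linarith
    · have hempty : (F.filter fun i : Fin N => dist (y i) p ≤ ρ) = ∅ := by
        refine Finset.filter_eq_empty_iff.mpr fun i hi hip => hp ?_
        have h1 := hF i hi
        have h2 := dist_triangle p (y i) c
        rw [dist_comm p (y i)] at h2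
        linarith
      rw [hempty, Finset.card_empty, Nat.cast_zero]
      have : (0 : ℝ) ≤ ((S.filter fun i : Fin N => dist (y i) p ≤ ρ).card : ℝ) := by positivity
      exact mul_nonneg hφ this
  have hLi : Integrable L := integrable_sum_indicator_closedBall y _ ρ
  have hRi : Integrable R := (integrable_sum_indicator_closedBall y _ ρ).const_mul φ
  have hint := integral_mono hLi hRi hLR
  set v1 : ℝ := (volume : Measure (EuclideanSpace ℝ (Fin 3))).real (ball 0 1) with hv1
  have hv1pos : 0 < v1 := ENNReal.toReal_pos (measure_ball_pos volume _ one_pos).ne' measure_ball_lt_top.ne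
  have hL' : ∫ p, L p = (F.card : ℝ) * (ρ ^ 3 * v1) := by
    rw [hL, integral_sum_indicator_closedBall y _ hρ.le, sum_ite_mem_one]
  have hR' : ∫ p, R p = φ * (S.card : ℝ) * (ρ ^ 3 * v1) := by
    rw [hR, integral_const_mul, integral_sum_indicator_closedBall y _ hρ.le, sum_ite_mem_one, mul_assoc]
  rw [hL', hR'] at hint
  have hpos : 0 < ρ ^ 3 * v1 := by positivity
  exact le_of_mul_le_mul_right hint hpos

/-- **Collar count**: the collar `{ρ₁ < |y_i − c| ≤ ρ₁ + 2ρ}` of a `δ`-separated configuration (`δ ≤ 1 ≤ ρ`, `3ρ ≤ ρ₁`, `18 ≤ ρ₁`) holds at most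
`288·δ⁻³·ρ·ρ₁²` particles (`ContactSaturationLadderWindowFloor.card_layer_le` and `(ρ₁+2ρ+δ/2)³ − (ρ₁−δ/2)³ ≤ 36·ρ·ρ₁²`). -/
theorem card_collar_le (y : Fin N → EuclideanSpace ℝ (Fin 3)) {δ : ℝ} (hδ : 0 < δ) (hδ1 : δ ≤ 1)
    (hsep : ∀ k l : Fin N, k ≠ l → δ ≤ dist (y k) (y l)) (c : EuclideanSpace ℝ (Fin 3)) {ρ ρ₁ : ℝ} (hρ : 1 ≤ ρ)
    (h3 : 3 * ρ ≤ ρ₁) (h18 : 18 ≤ ρ₁) :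
    ((Finset.univ.filter fun i : Fin N => ρ₁ < dist (y i) c ∧ dist (y i) c ≤ ρ₁ + 2 * ρ).card : ℝ) ≤ 288 * δ⁻¹ ^ 3 * ρ * ρ₁ ^ 2 := by
  have h := card_layer_le y hδ hsep c (R₁ := ρ₁) (R₂ := ρ₁ + 2 * ρ) (by linarith) (by linarith)
  set a : ℝ := ρ₁ + 2 * ρ + δ / 2 with ha
  set b : ℝ := ρ₁ - δ / 2 with hb
  have hb0 : 0 ≤ b := by rw [hb]; linarith
  have hab : b ≤ a := by rw [ha, hb]; linarith
  have ha2 : a ≤ 2 * ρ₁ := by rw [ha]; linarith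
  have ha0 : 0 ≤ a := hb0.trans hab
  have hdiff : a - b ≤ 3 * ρ := by rw [ha, hb]; linarith
  have hcube : a ^ 3 - b ^ 3 ≤ 36 * ρ * ρ₁ ^ 2 := by
    have e : a ^ 3 - b ^ 3 = (a - b) * (a ^ 2 + a * b + b ^ 2) := by ring
    have hq : a ^ 2 + a * b + b ^ 2 ≤ 3 * a ^ 2 := by nlinarith [mul_le_mul_of_nonneg_left hab ha0, pow_le_pow_left₀ hb0 hab 2]
    have hq0 : 0 ≤ a ^ 2 + a * b + b ^ 2 := by positivity
    have ha2' : a ^ 2 ≤ (2 * ρ₁) ^ 2 := pow_le_pow_left₀ ha0 ha2 2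
    rw [e]
    calc (a - b) * (a ^ 2 + a * b + b ^ 2) ≤ (3 * ρ) * (a ^ 2 + a * b + b ^ 2) := mul_le_mul_of_nonneg_right hdiff hq0
      _ ≤ (3 * ρ) * (3 * (2 * ρ₁) ^ 2) := mul_le_mul_of_nonneg_left (hq.trans (by linarith)) (by linarith)
      _ = 36 * ρ * ρ₁ ^ 2 := by ring
  have hδ3 : (0 : ℝ) < (δ / 2) ^ 3 := by positivity
  have h1 : ((Finset.univ.filter fun i : Fin N => ρ₁ < dist (y i) c ∧ dist (y i) c ≤ ρ₁ + 2 * ρ).card : ℝ) * (δ / 2) ^ 3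
      ≤ 36 * ρ * ρ₁ ^ 2 := h.trans hcube
  have h2 : ((Finset.univ.filter fun i : Fin N => ρ₁ < dist (y i) c ∧ dist (y i) c ≤ ρ₁ + 2 * ρ).card : ℝ)
      ≤ 36 * ρ * ρ₁ ^ 2 / (δ / 2) ^ 3 := (le_div_iff₀ hδ3).2 h1
  have h3' : 36 * ρ * ρ₁ ^ 2 / (δ / 2) ^ 3 = 288 * δ⁻¹ ^ 3 * ρ * ρ₁ ^ 2 := by
    field_simp
    ring
  linarith [h2, h3'.le]

/-- **Ball = inner ball ⊔ collar** (as a real count): `#B(c, ρ₁+2ρ) = #B(c,ρ₁) + #{ρ₁ < |y_i − c| ≤ ρ₁+2ρ}`. -/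
theorem card_ball_eq_inner_add_collar (y : Fin N → EuclideanSpace ℝ (Fin 3)) (c : EuclideanSpace ℝ (Fin 3)) (ρ ρ₁ : ℝ) (hρ : 0 ≤ ρ) :
    ((Finset.univ.filter fun i : Fin N => dist (y i) c ≤ ρ₁ + 2 * ρ).card : ℝ)
      = ((Finset.univ.filter fun i : Fin N => dist (y i) c ≤ ρ₁).card : ℝ)
        + ((Finset.univ.filter fun i : Fin N => ρ₁ < dist (y i) c ∧ dist (y i) c ≤ ρ₁ + 2 * ρ).card : ℝ) := by
  have hunion : (Finset.univ.filter fun i : Fin N => dist (y i) c ≤ ρ₁ + 2 * ρ)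
      = (Finset.univ.filter fun i : Fin N => dist (y i) c ≤ ρ₁)
        ∪ (Finset.univ.filter fun i : Fin N => ρ₁ < dist (y i) c ∧ dist (y i) c ≤ ρ₁ + 2 * ρ) := by
    ext i
    simp only [Finset.mem_union, Finset.mem_filter, Finset.mem_univ, true_and]
    constructor
    · intro hi
      by_cases h1 : dist (y i) c ≤ ρ₁
      · exact Or.inl h1
      · exact Or.inr ⟨not_le.mp h1, hi⟩
    · rintro (hi | hi)
      · linarith
      · exact hi.2
  have hdisj : Disjoint (Finset.univ.filter fun i : Fin N => dist (y i) c ≤ ρ₁)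
      (Finset.univ.filter fun i : Fin N => ρ₁ < dist (y i) c ∧ dist (y i) c ≤ ρ₁ + 2 * ρ) := by
    rw [Finset.disjoint_left]
    intro i hi hi'
    simp only [Finset.mem_filter, Finset.mem_univ, true_and] at hi hi'
    linarith [hi'.1]
  rw [hunion, Finset.card_union_of_disjoint hdisj, Nat.cast_add]

/-- **Loss-free fraction transfer** (GS-free): for a `δ`-separated configuration (`δ ≤ 1`), radii `1 ≤ ρ`, `3ρ ≤ ρ₁`, `18 ≤ ρ₁`, a filling bound
`ρ₁³ ≤ K·#B(c,ρ₁)` and a marked set `F ⊆ B(c,ρ₁)` whose local fraction in every window `B(p,ρ)` centred within `ρ₁ + ρ` of `c` is at most `φ ≥ 0`: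
`#F ≤ φ·(1 + 288·K·δ⁻³·ρ/ρ₁)·#B(c,ρ₁)` — the loss factor tends to one as `ρ/ρ₁ → 0`. -/
theorem card_le_of_localFraction_fill (y : Fin N → EuclideanSpace ℝ (Fin 3)) {δ : ℝ} (hδ : 0 < δ) (hδ1 : δ ≤ 1)
    (hsep : ∀ k l : Fin N, k ≠ l → δ ≤ dist (y k) (y l)) (c : EuclideanSpace ℝ (Fin 3)) {ρ ρ₁ φ K : ℝ} (hρ : 1 ≤ ρ)
    (h3 : 3 * ρ ≤ ρ₁) (h18 : 18 ≤ ρ₁) (hφ : 0 ≤ φ)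
    (hfill : ρ₁ ^ 3 ≤ K * ((Finset.univ.filter fun i : Fin N => dist (y i) c ≤ ρ₁).card : ℝ))
    (F : Finset (Fin N)) (hF : ∀ i ∈ F, dist (y i) c ≤ ρ₁)
    (hloc : ∀ p : EuclideanSpace ℝ (Fin 3), dist p c ≤ ρ₁ + ρ →
      ((F.filter fun i : Fin N => dist (y i) p ≤ ρ).card : ℝ) ≤ φ * ((Finset.univ.filter fun i : Fin N => dist (y i) p ≤ ρ).card : ℝ)) :
    (F.card : ℝ) ≤ φ * (1 + 288 * K * δ⁻¹ ^ 3 * (ρ / ρ₁)) * ((Finset.univ.filter fun i : Fin N => dist (y i) c ≤ ρ₁).card : ℝ) := by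
  set B₁ := Finset.univ.filter (fun i : Fin N => dist (y i) c ≤ ρ₁) with hB₁
  have hρ0 : 0 < ρ := by linarith
  have hρ₁0 : 0 < ρ₁ := by linarith
  have havg := card_le_of_localFraction y c hρ0 hφ F hF hloc
  have hsplit := card_ball_eq_inner_add_collar y c ρ ρ₁ hρ0.le
  have hcol := card_collar_le y hδ hδ1 hsep c hρ h3 h18
  have hcol' : 288 * δ⁻¹ ^ 3 * ρ * ρ₁ ^ 2 ≤ 288 * K * δ⁻¹ ^ 3 * (ρ / ρ₁) * (B₁.card : ℝ) := by
    have e1 : 288 * δ⁻¹ ^ 3 * ρ * ρ₁ ^ 2 = 288 * δ⁻¹ ^ 3 * (ρ / ρ₁) * ρ₁ ^ 3 := by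
      field_simp
    rw [e1]
    have h0 : 0 ≤ 288 * δ⁻¹ ^ 3 * (ρ / ρ₁) := by positivity
    calc 288 * δ⁻¹ ^ 3 * (ρ / ρ₁) * ρ₁ ^ 3 ≤ 288 * δ⁻¹ ^ 3 * (ρ / ρ₁) * (K * (B₁.card : ℝ)) :=
          mul_le_mul_of_nonneg_left hfill h0
      _ = 288 * K * δ⁻¹ ^ 3 * (ρ / ρ₁) * (B₁.card : ℝ) := by ring
  calc (F.card : ℝ) ≤ φ * ((Finset.univ.filter fun i : Fin N => dist (y i) c ≤ ρ₁ + 2 * ρ).card : ℝ) := havg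
    _ = φ * ((B₁.card : ℝ) + ((Finset.univ.filter fun i : Fin N => ρ₁ < dist (y i) c ∧ dist (y i) c ≤ ρ₁ + 2 * ρ).card : ℝ)) := by
        rw [hsplit]
    _ ≤ φ * ((B₁.card : ℝ) + 288 * K * δ⁻¹ ^ 3 * (ρ / ρ₁) * (B₁.card : ℝ)) :=
        mul_le_mul_of_nonneg_left (by linarith [hcol, hcol']) hφ
    _ = φ * (1 + 288 * K * δ⁻¹ ^ 3 * (ρ / ρ₁)) * (B₁.card : ℝ) := by ring

end Summit.AtomisticToContinuum.Crystallization.Theorems.ContactSaturationLadderFractionTransfer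

end
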